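import Literature.Computability.AlgebraicComplexity.LMR13SegreDimensionProofs
import HarnessLib

/-!
# Landsberg–Manivel–Ressayre 2013, Theorem 2.3.1: the equation of the flag `D ⊂ L ⊂ F` is a nonzero
# highest-weight vector of weight `Ω(k,d)^*` and degree `(k+2)(d−1)` vanishing on `Dual_{k,d,N}` —
# discharge of `LMR2013_thm_2_3_1`

Proofs-only sibling of `Literature/Computability/AlgebraicComplexity/LMR13DualVarieties.lean` (the typed
statements of J. M. Landsberg, L. Manivel, N. Ressayre, *Hypersurfaces with degenerate duals and the
Geometric Complexity Theory Program*, Comment. Math. Helv. **88** (2013) 469–484 = arXiv:1004.4802;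
cell `val-lit`, row `LMR13-A`, typer `val-lit-t11`; this file: `val-lit-t10`). Honest framing: this is
the formalisation of a published 2013 computation (the weight of LMR's equations); **VP ≠ VNP is NOT
proved and nothing here is progress on it.**

## What is proved (sorry-free, no new definitions of `Prop`s, net debt −1)

* `LMR2013_thm_2_3_1_holds : LMR2013_thm_2_3_1` — the named fact of `LMR13DualVarieties.lean`
  (Thm. 2.3.1: for `N ≥ k+3`, `d ≥ 3` a NONZERO polynomial function `F` on `S^d ℂ^N`, homogeneous of
  degree `(k+2)(d−1)`, a highest-weight vector of `coordRep (Fin N) ℂ d` of weight `Ω(k,d)^*`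
  (`Weight.dualOfPartition N (lmrOmegaPartition k d)`), vanishing on `Dual_{k,d,N}`
  (`dualDegenerateLocus`)) becomes a theorem. The vector is EXPLICIT: `F = lmrEqCoord f M d`
  (`LMRDetIdealModuleProofs.lean`), LMR's remainder equation `E_f = R̂_M(P_L(1,Y), det(H_P|_F)_L(1,Y))`
  of the COORDINATE flag `f = lmrOmegaFlag N k` of the `k+3` greatest coordinates of `ℂ^N`, at
  truncation order `M = e − d + 1 = (k+3)(d−2) − (d−1)` (`lmrOmegaM`).
* `lmrEqCoord_lmrOmegaFlag_spec` — its four properties separately, the last in the Segre-free form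
  "vanishes at every form `Q` of degree `d` dividing `det(H_Q|_F)`"; `LMR2013_thm_2_3_1_of_hessianRankBound`,
  `LMR2013_thm_2_3_1_of_segreDimensionFormula` — the theorem modulo (the `≤` half of) B. Segre's
  formula, and `LMR2013_thm_2_3_1_holds` by `segreDimensionFormula_holds`
  (`LMR13SegreDimensionProofs.lean`, `val-lit-t12`).

## The printed argument (LMR 2013 §2.2–§2.3, journal pp. 472–474, `paper:galaxy-pdf-8572435590081880720
p0005.txt:L1–31, p0006.txt:L1–39`) and how it is formalised

LMR: "if `F` contains `L` we get an equation depending only on the partial flag `D ⊂ L ⊂ F`. This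
equation must therefore be a highest weight vector in some module of polynomials on `S^n W^*`, and its
highest weight must be of the form `aω_1 + bω_2 + cω_{k+3}`" (p0005:L29); the weight is read off from the
rescalings (3) `R̂(αQ(x,λy), βP(x,λy)) = αβ^{e−d+1}λ^{e−d+1}R̂(Q,P)`, (4), (5): "the vector of exponents of
the action of `T` on our equation is `(2+e+(d−1)(e−d+1), e−d+3, 2(k+1))` … We deduce
`a = (d−1)(d−2)(k+2)`, `b = e−d+1 = d(k+2)−2k−5`, `c = 2`" (p0006:L9–27), and "These equations have
degree `(k+2)(d−1)`" (p0006:L37). This is EXACTLY the argument formalised for `det_n`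
(`(k,d,N) = (2n−2,n,n²)`) in `LMRDetIdealModuleWeight.lean` (§11–§18 there, cell `pub-gct-max`), whose
engine is stated for a general form, flag and commutative ring; the present file transports its last,
`det_n`-specific layer (§15–§18: the flag inside `MatIdx n`, the partition `λ(n) = Ω(2n−2,n)`) to the
general parameters `(k, d, N)` of Thm. 2.3.1, on the variables `Fin N`:
* §1 the arithmetic of `M = e − d + 1` (`e = M + d − 1`, `(k+3) + M = (k+2)(d−1)`, the parts
  `Ω₁ = a+b+c = dM + d + 1`, `Ω₂ = b + c = M + 2`, checked against `lmrOmegaParts`);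
* §2 the flag `lmrOmegaFlag` of the `k+3` greatest coordinates (an upper set, so an upper-triangular
  `B` restricts to it; rows `f 0`, `f 1` of `B`; `det(B|_F) = ∏ diagonal`);
* §3 NON-VANISHING at a test form (ours, not in the source — LMR obtain non-vanishing from the module
  structure; cf. `lmrWitness` for `det_n`, whose shape needs `d ∣ 2(k+2)`):
  `W_{k,d} = x^d + y^d + z_0² x y^{d−3} + Σ_{c ≥ 1} z_c² y^{d−2}` has `W_L(1,Y) = 1 + Y^d`, diagonal
  restricted Hessian `diag(d(d−1), d(d−1)Y^{d−2}, 2Y^{d−3}, 2Y^{d−2}, …)` with determinant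
  `d²(d−1)² 2^{k+1} Y^M` exactly, whence `E_f(W) = d²(d−1)² 2^{k+1} ≠ 0`;
* §4 `E_f(h ∘ Bᵀ) = det(B|_F)² · B₀₀^{dM+d−1} · B₁₁^{M} · E_f(h)` for `B` upper-triangular and
  `h(e_{f 0}) ≠ 0` (eqs. (3)–(5) for the full Borel: `hessGenMinor_linSubst`, `lineRestr_single_eq_lmrTwist`,
  the twist identity `lmrR_lmrTwist`);
* §5 the character: `χ_{Ω(k,d)^*}(g) = det(B|_F)² B₀₀^{dM+d−1} B₁₁^{M}`, `B = g⁻¹`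
  (`sortedParts (lmrOmegaPartition k d) = [dM+d+1, M+2, 2^{(k+1)}]`);
* §6 density: `g·E_f` and `χ(g)E_f` agree on `{h(e_{f 0}) ≠ 0}`, so `(g·E_f − χ(g)E_f)·X_{x^d} = 0`;
  degree `(k+3)+M = (k+2)(d−1)` (`lmrEqCoord_isHomogeneous`); `E_f ≠ 0` by §3;
* §7 VANISHING on `Dual_{k,d,N}` (LMR §2.1–§2.3, "`P ∈ Dual_{k,d,N}` iff for any `F`, `P` divides
  `det(H_P|_F)`", p. 472; "`D_L` contributes only up to degree `e − d`", p. 473): a form `Q` dividing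
  `det(H_Q|_F)` has `E_f(Q) = 0` (`lmrEq_eq_zero_of_eq_mul`, the cofactor replaced by its component of
  degree `e − d = M − 1`); an irreducible `Q` whose Hessian has rank `≤ k+2` on `Z(Q)` off a hypersurface
  not containing `Z(Q)` divides `det(H_Q|_F)` (Nullstellensatz, `dvd_of_prime_of_forall_eval_eq_zero`) —
  that rank bound is B. Segre's formula `dim Z(Q)^* = rank H − 2` at the general point
  (`segreDimensionFormula_holds`); and `E_f`, a polynomial in the coefficients, then vanishes on the
  Zariski closure `Dual_{k,d,N}` of these `Q` (`mem_zariskiClosure_iff`);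
* §8 assembly.

Conventions as in `LMRDetIdealModuleWeight.lean`: `coordRep` acts by `(g·F)(h) = F(h ∘ (g⁻¹)ᵀ)`,
`highestWeightSpace` = semi-invariants of the UPPER triangular Borel, and
`Weight.dualOfPartition N Ω (rev j) = −Ω_{j+1}`, so the weight vector lives on the GREATEST coordinates.

## References

* [LandsbergManivelRessayre2013] J. M. Landsberg, L. Manivel, N. Ressayre, Comment. Math. Helv. 88
  (2013) 469–484, doi:10.4171/CMH/292 — §2.1 (p. 472), §2.2 eqs. (1)–(3) (pp. 472–473), §2.3
  eqs. (4)–(5) and Theorem 2.3.1 (pp. 473–474) `[corpus:paper:galaxy-pdf-8572435590081880720 p0004–p0006]`;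
  arXiv:1004.4802 `[corpus:paper:arxiv-1004.4802 p0004–p0005]`.
* [GelfandKapranovZelevinsky1994] Ch. 1 (B. Segre's / Katz's dimension formula), via
  `segreDimensionFormula_holds`.

## Mathlib and tree

Tree: `lmrR`, `lmrS`, `lmrEq`, `lmrEqCoord`, `selMatrix`, `planeRestr`, `planeRestr_monomial`,
`planeRestr_pderiv_pderiv_X_pow`, `planeRestr_pderiv_pderiv_sq_mul`, `planeRestr_hessGenMinor_selMatrix`,
`lmrEq_eq_zero_of_eq_mul`, `aeval_formCoeff_lmrEqCoord`, `eval_lmrEqCoord`, `lmrEqCoord_isHomogeneous`,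
`lmrEqCoord_ne_zero` (`LMRDetIdealModuleProofs.lean`); `lmrTwist`, `lmrR_lmrTwist`, `hessGenMinor_linSubst`,
`hessGenMinor_mul_mul`, `selMatrix_mul_eq_submatrix_mul`, `isHomogeneous_hessGenMinor`,
`lineRestr_linSubst`, `lineRestr_single_eq_lmrTwist`, `natDegree_planeRestr_le`, `coeff_zero_planeRestr`,
`planeRestr_C`, `lmrR_C_mul_right` (`LMRDetIdealModuleWeight.lean`); `lmrOmegaPartition`,
`lmrOmegaPartition_parts`, `lmrOmegaParts`, `dualDegenerateLocus`, `dualVarietyDim`, `SegreDimensionFormula`,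
`LMR2013_thm_2_3_1` (`LMR13DualVarieties.lean`); `homogeneousComponent_mul_left`
(`LMR13DualSchemeDetProofs.lean`); `segreDimensionFormula_holds` (`LMR13SegreDimensionProofs.lean`);
`coordRep_apply`, `coordSubst`, `aeval_formCoeff_coordSubst`, `formCoeff`, `DegIdx`, `mem_degMonomials_iff`
(`OrbitCoordinateRing.lean`); `coeffVec`, `mem_zariskiClosure_iff` (`OrbitClosure.lean`); `linSubst`,
`linSubst_C`, `linSubst_isHomogeneous`, `linSubstRep_apply` (`LinSubst.lean`); `highestWeightSpace`,
`mem_highestWeightSpace_iff`, `weightChar`, `weightChar_mul`, `weightChar_one`, `IsUpperTriangular`,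
`borelSubgroup`, `Weight.dualOfPartition` (`GLHighestWeight.lean`); `formCoeff_sum_monomial`,
`isHomogeneous_sum_monomial` (`SchurWeylPlethysmCoordRepWeightsProofs.lean`); `hessianMatrix`,
`eval_hessGenMinor`, `det_mul_mul_transpose_eq_zero_of_rank_le`, `dvd_of_prime_of_forall_eval_eq_zero`;
`Nat.Partition.sortedParts`. Mathlib: `Matrix.det_of_lowerTriangular`, `Matrix.BlockTriangular`,
`Matrix.single_one_vecMul`, `Matrix.det_diagonal`, `Fin.rev`, `Fin.castLE`, `Fin.revPerm`,
`List.mergeSort_eq_self`, `MvPolynomial.funext`, `MvPolynomial.aeval_rename`,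
`UniqueFactorizationMonoid.irreducible_iff_prime`.
-/

noncomputable section

open MvPolynomial Matrix Polynomial

namespace Literature.Computability.AlgebraicComplexity

open _root_.Literature.NumberTheory.DiophantineGeometry

section Params

/-- The truncation order `M = e − d + 1 = (k+3)(d−2) − (d−1)` of the remainder functional `R̂_M` for
forms of degree `d` and `(k+3)`-planes `F` (LMR 2013 §2.2–§2.3: "of degree `e − d + 1` in those of
`P_L`", `e = (k+3)(d−2)`; journal p. 473, `paper:galaxy-pdf-8572435590081880720 p0005.txt:L22–29`; also
`b = e − d + 1`, p0006:L25). `ℕ`-subtraction is exact for `d ≥ 3`.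
[cite: LandsbergManivelRessayre2013, §2.2–§2.3 (p. 473)] -/
def lmrOmegaM (κ d : ℕ) : ℕ := (κ + 3) * (d - 2) - (d - 1)

/-- `e = (k+3)(d−2) = M + d − 1` for `d ≥ 3`. [cite: LandsbergManivelRessayre2013, §2.3 (p. 473)] -/
theorem flag_card_mul_eq_lmrOmegaM {κ d : ℕ} (hd : 3 ≤ d) :
    (κ + 1 + 2) * (d - 2) = lmrOmegaM κ d + d - 1 := by
  obtain ⟨t, rfl⟩ := Nat.exists_eq_add_of_le' hd
  rw [lmrOmegaM, show t + 3 - 2 = t + 1 by omega, show t + 3 - 1 = t + 2 by omega]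
  have h3 : t + 2 ≤ (κ + 3) * (t + 1) := by nlinarith
  have h4 : (κ + 1 + 2) * (t + 1) = (κ + 3) * (t + 1) := by ring
  rw [h4]
  omega

/-- `1 ≤ M` for `d ≥ 3`. [cite: LandsbergManivelRessayre2013, §2.3 (p. 473)] -/
theorem one_le_lmrOmegaM {κ d : ℕ} (hd : 3 ≤ d) : 1 ≤ lmrOmegaM κ d := by
  obtain ⟨t, rfl⟩ := Nat.exists_eq_add_of_le' hd
  rw [lmrOmegaM, show t + 3 - 2 = t + 1 by omega, show t + 3 - 1 = t + 2 by omega]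
  have h3 : 3 * (t + 1) ≤ (κ + 3) * (t + 1) := Nat.mul_le_mul_right _ (by omega)
  omega

/-- **The degree**: `(k+3) + M = (k+2)(d−1)` for `d ≥ 3` ("These equations have degree `(k+2)(d−1)`",
`paper:galaxy-pdf-8572435590081880720 p0006.txt:L37`). [cite: LandsbergManivelRessayre2013, Theorem 2.3.1 (p. 474)] -/
theorem flag_card_add_lmrOmegaM {κ d : ℕ} (hd : 3 ≤ d) :
    κ + 1 + 2 + lmrOmegaM κ d = (κ + 2) * (d - 1) := by
  obtain ⟨t, rfl⟩ := Nat.exists_eq_add_of_le' hd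
  rw [lmrOmegaM, show t + 3 - 2 = t + 1 by omega, show t + 3 - 1 = t + 2 by omega]
  have h3 : t + 2 ≤ (κ + 3) * (t + 1) := by nlinarith
  zify [h3]
  ring

/-- The second part of `Ω(k,d)`: `b + c = (d(k+2) − 2k − 5) + 2 = M + 2` for `d ≥ 3` ("`b = e − d + 1`",
`paper:galaxy-pdf-8572435590081880720 p0006.txt:L25`). [cite: LandsbergManivelRessayre2013, Theorem 2.3.1 (p. 474)] -/
theorem lmrOmegaParts_snd_eq {κ d : ℕ} (hd : 3 ≤ d) :
    (d * (κ + 2) - 2 * κ - 5) + 2 = lmrOmegaM κ d + 2 := by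
  obtain ⟨t, rfl⟩ := Nat.exists_eq_add_of_le' hd
  rw [lmrOmegaM, show t + 3 - 2 = t + 1 by omega, show t + 3 - 1 = t + 2 by omega]
  have h1 : 2 * κ ≤ (t + 3) * (κ + 2) := by nlinarith
  have h2 : 5 ≤ (t + 3) * (κ + 2) - 2 * κ := by
    have : (t + 3) * (κ + 2) = t * κ + 2 * t + 3 * κ + 6 := by ring
    omega
  have h3 : t + 2 ≤ (κ + 3) * (t + 1) := by nlinarith
  zify [h1, h2, h3]
  ring

/-- The first part of `Ω(k,d)`: `a + b + c = (d−1)(d−2)(k+2) + (d(k+2) − 2k − 5) + 2 = dM + (d−1) + 2` for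
`d ≥ 3` ("`a + b + c = 2 + e + (d−1)(e−d+1)`", `paper:galaxy-pdf-8572435590081880720 p0006.txt:L9–23`).
[cite: LandsbergManivelRessayre2013, Theorem 2.3.1 (p. 474)] -/
theorem lmrOmegaParts_fst_eq {κ d : ℕ} (hd : 3 ≤ d) :
    (d - 1) * (d - 2) * (κ + 2) + (d * (κ + 2) - 2 * κ - 5) + 2 =
      d * lmrOmegaM κ d + (d - 1) + 2 := by
  obtain ⟨t, rfl⟩ := Nat.exists_eq_add_of_le' hd
  rw [lmrOmegaM, show t + 3 - 2 = t + 1 by omega, show t + 3 - 1 = t + 2 by omega]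
  have h1 : 2 * κ ≤ (t + 3) * (κ + 2) := by nlinarith
  have h2 : 5 ≤ (t + 3) * (κ + 2) - 2 * κ := by
    have : (t + 3) * (κ + 2) = t * κ + 2 * t + 3 * κ + 6 := by ring
    omega
  have h3 : t + 2 ≤ (κ + 3) * (t + 1) := by nlinarith
  zify [h1, h2, h3]
  ring

/-- The `Y`-exponent of `det(H_W|_F)_L(1,Y)` for the test form: `(d−2) + (d−3) + k(d−2) = M` (`d ≥ 3`).
[cite: LandsbergManivelRessayre2013, §2.3 (p. 473)] -/
theorem witness_exponent_eq_lmrOmegaM {κ d : ℕ} (hd : 3 ≤ d) :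
    (d - 2) + ((d - 3) + κ * (d - 2)) = lmrOmegaM κ d := by
  obtain ⟨t, rfl⟩ := Nat.exists_eq_add_of_le' hd
  rw [lmrOmegaM, show t + 3 - 2 = t + 1 by omega, show t + 3 - 1 = t + 2 by omega,
    show t + 3 - 3 = t by omega]
  have h3 : t + 2 ≤ (κ + 3) * (t + 1) := by nlinarith
  zify [h3]
  ring

end Params

/-! ### §2 The flag of the `k+3` greatest coordinates of `ℂ^N` -/

section Flag

variable {N κ : ℕ}

/-- **The flag `D ⊂ L ⊂ F` of the `k+3` GREATEST coordinates of `W = ℂ^N`** (descending):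
`f 0 = N−1` spans the line `D`, `f 0, f 1` the plane `L`, `f 0, …, f (k+2)` the `(k+3)`-plane `F`
(LMR 2013 §2.3, "Consider a basis adapted to `D ⊂ L ⊂ F`", journal p. 473,
`paper:galaxy-pdf-8572435590081880720 p0006.txt:L1–13`) — adapted to the Borel subgroup of upper
triangular matrices acting contragrediently on `k[Sym^d]` (`coordRep`), as `lmrFlag` is for `det_n`.
[cite: LandsbergManivelRessayre2013, §2.3 (p. 473)] -/
def lmrOmegaFlag (N κ : ℕ) (hN : κ + 3 ≤ N) : Fin (κ + 1 + 2) → Fin N :=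
  fun a => Fin.rev (Fin.castLE hN a)

/-- Unfolding. [cite: LandsbergManivelRessayre2013, §2.3 (p. 473)] -/
theorem lmrOmegaFlag_apply (hN : κ + 3 ≤ N) (a : Fin (κ + 1 + 2)) :
    lmrOmegaFlag N κ hN a = Fin.rev (Fin.castLE hN a) :=
  rfl

/-- The flag is strictly decreasing. [cite: LandsbergManivelRessayre2013, §2.3 (p. 473)] -/
theorem lmrOmegaFlag_strictAnti (hN : κ + 3 ≤ N) : StrictAnti (lmrOmegaFlag N κ hN) :=
  fun _ _ hab => Fin.rev_lt_rev.mpr hab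

/-- The flag consists of distinct coordinates. [cite: LandsbergManivelRessayre2013, §2.3 (p. 473)] -/
theorem lmrOmegaFlag_injective (hN : κ + 3 ≤ N) : Function.Injective (lmrOmegaFlag N κ hN) :=
  (lmrOmegaFlag_strictAnti hN).injective

/-- The image of the flag is an upper set of `Fin N`. [cite: LandsbergManivelRessayre2013, §2.3 (p. 473)] -/
theorem mem_range_lmrOmegaFlag_of_le (hN : κ + 3 ≤ N) {a : Fin (κ + 1 + 2)} {j : Fin N}
    (h : lmrOmegaFlag N κ hN a ≤ j) : j ∈ Set.range (lmrOmegaFlag N κ hN) := by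
  have hle : (Fin.rev j : ℕ) ≤ a := by
    have h1 : Fin.rev j ≤ Fin.rev (Fin.rev (Fin.castLE hN a)) := Fin.rev_le_rev.mpr h
    rw [Fin.rev_rev] at h1
    exact h1
  refine ⟨⟨Fin.rev j, lt_of_le_of_lt hle a.2⟩, ?_⟩
  rw [lmrOmegaFlag_apply]
  apply Fin.ext
  rw [Fin.val_rev]
  have hj := j.2
  simp only [Fin.val_castLE, Fin.val_rev]
  omega

/-- For an upper-triangular `B`, the rows of `B` indexed by the flag are supported on the flag (`B`
preserves the span `F` of the `k+3` greatest coordinates).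
[cite: LandsbergManivelRessayre2013, §2.3 (p. 473)] -/
theorem mem_range_lmrOmegaFlag_of_apply_ne_zero (hN : κ + 3 ≤ N) {A : Type*} [CommRing A]
    {B : Matrix (Fin N) (Fin N) A} (hB : B.BlockTriangular id) (a : Fin (κ + 1 + 2)) (j : Fin N)
    (h : B (lmrOmegaFlag N κ hN a) j ≠ 0) : j ∈ Set.range (lmrOmegaFlag N κ hN) := by
  apply mem_range_lmrOmegaFlag_of_le hN (a := a)
  by_contra hlt
  exact h (hB (not_le.mp hlt))

/-- Row `f 0` (the greatest coordinate) of an upper-triangular `B` is `B₀₀ e_{f 0}`.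
[cite: LandsbergManivelRessayre2013, §2.3, eq. (4) (p. 473)] -/
theorem row_lmrOmegaFlag_zero (hN : κ + 3 ≤ N) {A : Type*} [CommRing A]
    {B : Matrix (Fin N) (Fin N) A} (hB : B.BlockTriangular id) :
    B.row (lmrOmegaFlag N κ hN 0) =
      Pi.single (M := fun _ => A) (lmrOmegaFlag N κ hN 0)
        (B (lmrOmegaFlag N κ hN 0) (lmrOmegaFlag N κ hN 0)) := by
  funext i
  rw [Matrix.row_apply]
  by_cases hi : i = lmrOmegaFlag N κ hN 0
  · rw [hi, Pi.single_eq_same]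
  · rw [Pi.single_eq_of_ne hi]
    by_contra hne
    obtain ⟨b, rfl⟩ := mem_range_lmrOmegaFlag_of_apply_ne_zero hN hB 0 i hne
    have hb : b ≠ 0 := fun h => hi (by rw [h])
    have hlt : lmrOmegaFlag N κ hN b < lmrOmegaFlag N κ hN 0 :=
      lmrOmegaFlag_strictAnti hN (Fin.pos_iff_ne_zero.mpr hb)
    exact hne (hB hlt)

/-- Row `f 1` of an upper-triangular `B` is `B₁₀ e_{f 0} + B₁₁ e_{f 1}`.
[cite: LandsbergManivelRessayre2013, §2.3, eq. (4) (p. 473)] -/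
theorem row_lmrOmegaFlag_one (hN : κ + 3 ≤ N) {A : Type*} [CommRing A]
    {B : Matrix (Fin N) (Fin N) A} (hB : B.BlockTriangular id) :
    B.row (lmrOmegaFlag N κ hN 1) =
      Pi.single (M := fun _ => A) (lmrOmegaFlag N κ hN 0)
          (B (lmrOmegaFlag N κ hN 1) (lmrOmegaFlag N κ hN 0)) +
        Pi.single (M := fun _ => A) (lmrOmegaFlag N κ hN 1)
          (B (lmrOmegaFlag N κ hN 1) (lmrOmegaFlag N κ hN 1)) := by
  have h01 : lmrOmegaFlag N κ hN 0 ≠ lmrOmegaFlag N κ hN 1 := fun h =>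
    absurd (lmrOmegaFlag_injective hN h) Fin.zero_ne_one
  funext i
  rw [Matrix.row_apply, Pi.add_apply]
  by_cases hi0 : i = lmrOmegaFlag N κ hN 0
  · rw [hi0, Pi.single_eq_same, Pi.single_eq_of_ne h01, add_zero]
  by_cases hi1 : i = lmrOmegaFlag N κ hN 1
  · rw [hi1, Pi.single_eq_same, Pi.single_eq_of_ne (Ne.symm h01), zero_add]
  rw [Pi.single_eq_of_ne hi0, Pi.single_eq_of_ne hi1, add_zero]
  by_contra hne
  obtain ⟨b, rfl⟩ := mem_range_lmrOmegaFlag_of_apply_ne_zero hN hB 1 i hne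
  have hb : 1 < b := by
    rcases lt_trichotomy 1 b with h | h | h
    · exact h
    · exact absurd h.symm (fun h' => hi1 (by rw [h']))
    · have : b = 0 := by
        have : (b : ℕ) < 1 := h
        exact Fin.ext (by simpa using this)
      exact absurd this (fun h' => hi0 (by rw [h']))
  exact hne (hB (lmrOmegaFlag_strictAnti hN hb))

/-- The flag block `B|_{F×F}` of an upper-triangular `B` is lower-triangular in the flag's
(decreasing) enumeration, so its determinant is the product of the diagonal entries.
[cite: LandsbergManivelRessayre2013, §2.3, eq. (5) (p. 474)] -/
theorem det_submatrix_lmrOmegaFlag (hN : κ + 3 ≤ N) {A : Type*} [CommRing A]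
    {B : Matrix (Fin N) (Fin N) A} (hB : B.BlockTriangular id) :
    (B.submatrix (lmrOmegaFlag N κ hN) (lmrOmegaFlag N κ hN)).det =
      ∏ a, B (lmrOmegaFlag N κ hN a) (lmrOmegaFlag N κ hN a) := by
  rw [Matrix.det_of_lowerTriangular]
  · rfl
  · intro a b hab
    exact hB (lmrOmegaFlag_strictAnti hN hab)

end Flag

/-! ### §3 The test form `W_{k,d}` and the value of the equation on it -/

section Witness

variable {k : Type*} [Field k] {ι : Type*} [Fintype ι] [DecidableEq ι] {κ d : ℕ}

/-- The exponent of the `c`-th correction term of the test form: `x y^{d−3}` for `c = 0`, `y^{d−2}`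
otherwise. (A test form for the equation of the flag; the form is ours, not in the source, cf.
`witnessGamma` for `det_n`.) [cite: LandsbergManivelRessayre2013, §2.3 (p. 473)] -/
def omegaWitnessGamma (d : ℕ) (x y : ι) (c : Fin (κ + 1)) : ι →₀ ℕ :=
  if (c : ℕ) = 0 then Finsupp.single x 1 + Finsupp.single y (d - 3) else Finsupp.single y (d - 2)

/-- **The test form** `W_{k,d} = x^d + y^d + z_0² x y^{d−3} + Σ_{c ≥ 1} z_c² y^{d−2}`, a form of degree
`d` in the `k + 3` flag variables `x, y, z_0, …, z_k` (ours; chosen so that `det(H_W|_F)_L(1,Y)` is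
the monomial `d²(d−1)² 2^{k+1} Y^M`, `M = (k+3)(d−2) − (d−1)`).
[cite: LandsbergManivelRessayre2013, §2.3 (p. 473)] -/
def lmrOmegaWitness (κ d : ℕ) (x y : ι) (z : Fin (κ + 1) → ι) : MvPolynomial ι k :=
  MvPolynomial.monomial (Finsupp.single x d) 1 + MvPolynomial.monomial (Finsupp.single y d) 1 +
    ∑ c : Fin (κ + 1),
      MvPolynomial.monomial (Finsupp.single (z c) 2 + omegaWitnessGamma (κ := κ) d x y c) 1

omit [Fintype ι] [DecidableEq ι] in
/-- The correction exponents are supported in `{x, y}`. [cite: LandsbergManivelRessayre2013, §2.3 (p. 473)] -/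
theorem omegaWitnessGamma_apply_of_ne {x y : ι} (c : Fin (κ + 1)) {i : ι} (hix : i ≠ x)
    (hiy : i ≠ y) : omegaWitnessGamma (κ := κ) d x y c i = 0 := by
  unfold omegaWitnessGamma
  split_ifs <;> simp [Ne.symm hix, Ne.symm hiy]

omit [Fintype ι] [DecidableEq ι] in
/-- The `y`-exponent of the `c`-th correction term: `d − 3` for `c = 0`, else `d − 2`.
[cite: LandsbergManivelRessayre2013, §2.3 (p. 473)] -/
theorem omegaWitnessGamma_apply_y {x y : ι} (hxy : x ≠ y) (c : Fin (κ + 1)) :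
    omegaWitnessGamma (κ := κ) d x y c y = if (c : ℕ) = 0 then d - 3 else d - 2 := by
  unfold omegaWitnessGamma
  split_ifs <;> simp [hxy]

omit [Fintype ι] [DecidableEq ι] in
/-- Each correction exponent has degree `d − 2` (`d ≥ 3`). [cite: LandsbergManivelRessayre2013, §2.3 (p. 473)] -/
theorem degree_omegaWitnessGamma (hd : 3 ≤ d) (x y : ι) (c : Fin (κ + 1)) :
    (omegaWitnessGamma (κ := κ) d x y c).degree = d - 2 := by
  unfold omegaWitnessGamma
  split_ifs
  · rw [map_add, Finsupp.degree_single, Finsupp.degree_single]; omega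
  · rw [Finsupp.degree_single]

omit [Fintype ι] [DecidableEq ι] in
/-- The test form is a form of degree `d` (`d ≥ 3`). [cite: LandsbergManivelRessayre2013, §2.3 (p. 473)] -/
theorem lmrOmegaWitness_isHomogeneous (hd : 3 ≤ d) (x y : ι) (z : Fin (κ + 1) → ι) :
    (lmrOmegaWitness (k := k) κ d x y z).IsHomogeneous d := by
  unfold lmrOmegaWitness
  refine ((isHomogeneous_monomial _ ?_).add (isHomogeneous_monomial _ ?_)).add
    (IsHomogeneous.sum _ _ _ fun c _ => isHomogeneous_monomial _ ?_)
  · rw [Finsupp.degree_single]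
  · rw [Finsupp.degree_single]
  · rw [map_add, Finsupp.degree_single, degree_omegaWitnessGamma hd]; omega

variable {x y : ι} {z : Fin (κ + 1) → ι}

/-- Plane restriction of the test form: `W(e_x + Y e_y) = 1 + Y^d`.
[cite: LandsbergManivelRessayre2013, §2.2 (`P_L(1, y)`, p. 473)] -/
theorem planeRestr_lmrOmegaWitness (hxy : x ≠ y) (hzx : ∀ c, z c ≠ x) (hzy : ∀ c, z c ≠ y) :
    planeRestr (A := k) x y (lmrOmegaWitness (k := k) κ d x y z) = 1 + Polynomial.X ^ d := by
  unfold lmrOmegaWitness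
  rw [map_add, map_add, map_sum, planeRestr_monomial hxy, planeRestr_monomial hxy, if_pos, if_pos]
  · rw [Finset.sum_eq_zero]
    · simp [Ne.symm hxy]
    · intro c _
      rw [planeRestr_monomial hxy, if_neg]
      intro h
      have := h (z c) (hzx c) (hzy c)
      simp [omegaWitnessGamma_apply_of_ne c (hzx c) (hzy c)] at this
  · intro i hix hiy; simp [Ne.symm hiy]
  · intro i hix hiy; simp [Ne.symm hix]

/-- The diagonal of the restricted Hessian of the test form on the flag variables `(x, y, z_0, …)`:
`(d(d−1), d(d−1)Y^{d−2}, 2Y^{d−3}, 2Y^{d−2}, …, 2Y^{d−2})`.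
[cite: LandsbergManivelRessayre2013, §2.1 (`H_P|_F`, p. 472)] -/
def omegaWitnessDiag (κ d : ℕ) : Fin (κ + 1 + 2) → k[X] :=
  Fin.cons (Polynomial.C ((d : k) * ((d - 1 : ℕ) : k)))
    (Fin.cons (Polynomial.C ((d : k) * ((d - 1 : ℕ) : k)) * Polynomial.X ^ (d - 2))
      fun c => Polynomial.C (2 : k) * Polynomial.X ^ (if (c : ℕ) = 0 then d - 3 else d - 2))

/-- **The restricted Hessian of the test form on the flag is diagonal.**
[cite: LandsbergManivelRessayre2013, §2.1–2.2 (`(H_P|_F)_L`, pp. 472–473)] -/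
theorem planeRestr_pderiv_pderiv_lmrOmegaWitness (hinj : Function.Injective
      (Fin.cons x (Fin.cons y z : Fin (κ + 1 + 1) → ι) : Fin (κ + 1 + 2) → ι))
    (a b : Fin (κ + 1 + 2)) :
    planeRestr (A := k) x y (pderiv ((Fin.cons x (Fin.cons y z : Fin (κ + 1 + 1) → ι) :
        Fin (κ + 1 + 2) → ι) a) (pderiv ((Fin.cons x (Fin.cons y z :
        Fin (κ + 1 + 1) → ι) : Fin (κ + 1 + 2) → ι) b) (lmrOmegaWitness (k := k) κ d x y z))) =
      Matrix.diagonal (omegaWitnessDiag (k := k) κ d) a b := by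
  set f : Fin (κ + 1 + 2) → ι := Fin.cons x (Fin.cons y z : Fin (κ + 1 + 1) → ι) with hf
  have hf0 : f 0 = x := rfl
  have hf1 : f 1 = y := rfl
  have hfz : ∀ c : Fin (κ + 1), f c.succ.succ = z c := fun c => rfl
  have hxy : x ≠ y := by
    intro h; have := @hinj 0 1 (by rw [hf0, hf1, h]); exact Fin.zero_ne_one this
  have hzx : ∀ c, z c ≠ x := by
    intro c h; have := @hinj c.succ.succ 0 (by rw [hfz, hf0, h]); exact Fin.succ_ne_zero _ this
  have hzy : ∀ c, z c ≠ y := by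
    intro c h
    have := @hinj c.succ.succ 1 (by rw [hfz, hf1, h])
    exact Fin.succ_ne_zero _ (Fin.succ_injective _ this)
  have hγ : ∀ c i, i ≠ x → i ≠ y → omegaWitnessGamma (κ := κ) d x y c i = 0 :=
    fun c i hix hiy => omegaWitnessGamma_apply_of_ne c hix hiy
  -- expand by linearity
  unfold lmrOmegaWitness
  simp only [map_add, map_sum]
  rw [planeRestr_pderiv_pderiv_X_pow hxy (Or.inl rfl), planeRestr_pderiv_pderiv_X_pow hxy (Or.inr rfl)]
  simp only [fun c => planeRestr_pderiv_pderiv_sq_mul (A := k) hxy (hzx c) (hzy c) (hγ c) (f a) (f b)]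
  -- identify `f a = x` etc. with conditions on the indices
  have hax : ∀ a, f a = x ↔ a = 0 := fun a => by
    rw [← hf0]; exact hinj.eq_iff
  have hay : ∀ a, f a = y ↔ a = 1 := fun a => by
    rw [← hf1]; exact hinj.eq_iff
  have haz : ∀ a c, f a = z c ↔ a = c.succ.succ := fun a c => by
    rw [← hfz]; exact hinj.eq_iff
  simp only [hax, hay, haz, omegaWitnessGamma_apply_y hxy, Finsupp.single_apply, hxy, if_false,
    if_true]
  rw [Matrix.diagonal_apply]
  -- the index facts `succ (succ c) ≠ 0, 1` in `iff False` form, for `simp`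
  have hs0 : ∀ c : Fin (κ + 1), (c.succ.succ = (0 : Fin (κ + 1 + 2))) ↔ False :=
    fun c => ⟨fun h => Fin.succ_ne_zero _ h, False.elim⟩
  have h0s : ∀ c : Fin (κ + 1), ((0 : Fin (κ + 1 + 2)) = c.succ.succ) ↔ False :=
    fun c => ⟨fun h => Fin.succ_ne_zero _ h.symm, False.elim⟩
  have hs1 : ∀ c : Fin (κ + 1), (c.succ.succ = (1 : Fin (κ + 1 + 2))) ↔ False :=
    fun c => ⟨fun h => Fin.succ_ne_zero _ (Fin.succ_injective _ h), False.elim⟩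
  have h1s : ∀ c : Fin (κ + 1), ((1 : Fin (κ + 1 + 2)) = c.succ.succ) ↔ False :=
    fun c => ⟨fun h => Fin.succ_ne_zero _ (Fin.succ_injective _ h.symm), False.elim⟩
  -- case analysis on the two indices
  cases a using Fin.cases with
  | zero =>
    cases b using Fin.cases with
    | zero => simp [omegaWitnessDiag, h0s]
    | succ b' => simp [Fin.succ_ne_zero, (Fin.succ_ne_zero _).symm]
  | succ a' =>
    cases a' using Fin.cases with
    | zero =>
      cases b using Fin.cases with
      | zero => simp [h0s, h1s]
      | succ b' =>
        cases b' using Fin.cases with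
        | zero => simp [omegaWitnessDiag, h1s]
        | succ c => simp [Fin.succ_ne_zero, Fin.succ_inj, hs1, h1s]
    | succ c =>
      cases b using Fin.cases with
      | zero => simp [Fin.succ_ne_zero, h0s]
      | succ b' =>
        cases b' using Fin.cases with
        | zero => simp [Fin.succ_ne_zero, Fin.succ_inj, hs1, h1s]
        | succ e =>
          by_cases hce : c = e
          · subst hce
            simp [omegaWitnessDiag, Fin.succ_inj, hs0, hs1]
          · have hce' : ∀ e' : Fin (κ + 1), (c = e' ∧ e = e') ↔ False :=
              fun e' => ⟨fun h => hce (h.1.trans h.2.symm), False.elim⟩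
            simp [Fin.succ_inj, hs0, hs1, hce, hce']

/-- The determinant of the (diagonal) restricted Hessian of the test form: `d²(d−1)² 2^{k+1} · Y^M`.
[cite: LandsbergManivelRessayre2013, §2.3 (`Q_L = det(H_P|_F)_L`, p. 473)] -/
theorem det_diagonal_omegaWitnessDiag (hd : 3 ≤ d) :
    (Matrix.diagonal (omegaWitnessDiag (k := k) κ d)).det =
      Polynomial.C ((((d : k) * ((d - 1 : ℕ) : k)) ^ 2) * 2 ^ (κ + 1)) *
        Polynomial.X ^ lmrOmegaM κ d := by
  have h0 : 0 < κ + 1 := Nat.succ_pos κ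
  rw [Matrix.det_diagonal, Fin.prod_univ_succ, Fin.prod_univ_succ]
  simp only [omegaWitnessDiag, Fin.cons_zero, Fin.cons_succ]
  rw [Finset.prod_mul_distrib, Finset.prod_const, Finset.card_univ, Fintype.card_fin,
    Finset.prod_pow_eq_pow_sum]
  have hsum : ∑ c : Fin (κ + 1), (if (c : ℕ) = 0 then d - 3 else d - 2) = (d - 3) + κ * (d - 2) := by
    rw [Fin.sum_univ_succ]
    simp only [Fin.val_zero, if_true, Fin.val_succ, Nat.succ_ne_zero, if_false, Finset.sum_const,
      Finset.card_univ, Fintype.card_fin, smul_eq_mul]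
  rw [hsum, ← witness_exponent_eq_lmrOmegaM hd, pow_add, pow_add]
  simp only [map_mul, map_pow]
  ring

/-- LMR's remainder functional on the test data: `R̂_M(1 + Y^d, c Y^M) = c` (`d ≥ 1`).
[cite: LandsbergManivelRessayre2013, §2.2, eq. (2) (p. 473)] -/
theorem lmrR_one_add_X_pow_monomial {M e : ℕ} (he : 1 ≤ e) (c : k) :
    lmrR M (1 + Polynomial.X ^ e) (Polynomial.C c * Polynomial.X ^ M) = c := by
  have he0 : e ≠ 0 := by omega
  rw [lmrR, lmrS]
  have hc0 : (1 + Polynomial.X ^ e : k[X]).coeff 0 = 1 := by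
    rw [Polynomial.coeff_add, Polynomial.coeff_one_zero, Polynomial.coeff_X_pow, if_neg he0.symm,
      add_zero]
  rw [hc0, map_one]
  simp only [one_pow, mul_one, add_sub_cancel_left]
  rw [Finset.mul_sum, Polynomial.finsetSum_coeff]
  have hterm : ∀ i, (Polynomial.C c * Polynomial.X ^ M * (-Polynomial.X ^ e) ^ i : k[X]).coeff M =
      if M = e * i + M then c * (-1) ^ i else 0 := by
    intro i
    have : (Polynomial.C c * Polynomial.X ^ M * (-Polynomial.X ^ e) ^ i : k[X]) =
        Polynomial.C (c * (-1) ^ i) * Polynomial.X ^ (e * i + M) := by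
      rw [neg_pow, ← pow_mul, map_mul, map_pow, map_neg, map_one, pow_add]
      ring
    rw [this, Polynomial.coeff_C_mul_X_pow]
  rw [Finset.sum_congr rfl fun i _ => hterm i, Finset.sum_eq_single 0]
  · simp
  · intro i _ hi
    rw [if_neg]
    intro h
    have : e * i = 0 := by omega
    rcases Nat.mul_eq_zero.mp this with h' | h'
    · exact he0 h'
    · exact hi h'
  · intro h
    exact absurd (Finset.mem_range.mpr (Nat.succ_pos M)) h

/-- **The equation of the flag on the test form**: `E(W_{k,d}) = d²(d−1)² 2^{k+1}`.
[cite: LandsbergManivelRessayre2013, §2.3 (the equation of the flag, evaluated; p. 473)] -/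
theorem lmrEq_lmrOmegaWitness (hd : 3 ≤ d) (hinj : Function.Injective
      (Fin.cons x (Fin.cons y z : Fin (κ + 1 + 1) → ι) : Fin (κ + 1 + 2) → ι)) :
    lmrEq (Fin.cons x (Fin.cons y z : Fin (κ + 1 + 1) → ι) : Fin (κ + 1 + 2) → ι)
        (lmrOmegaM κ d) (lmrOmegaWitness (k := k) κ d x y z) =
      ((d : k) * ((d - 1 : ℕ) : k)) ^ 2 * 2 ^ (κ + 1) := by
  have hxy : x ≠ y := by
    intro h
    have := @hinj 0 1 (by simp [h])
    exact Fin.zero_ne_one this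
  have hzx : ∀ c, z c ≠ x := by
    intro c h
    have := @hinj c.succ.succ 0 (by simp [h])
    exact Fin.succ_ne_zero _ this
  have hzy : ∀ c, z c ≠ y := by
    intro c h
    have := @hinj c.succ.succ 1 (by simp [h])
    exact Fin.succ_ne_zero _ (Fin.succ_injective _ this)
  rw [lmrEq]
  have h0 : (Fin.cons x (Fin.cons y z : Fin (κ + 1 + 1) → ι) : Fin (κ + 1 + 2) → ι) 0 = x := rfl
  have h1 : (Fin.cons x (Fin.cons y z : Fin (κ + 1 + 1) → ι) : Fin (κ + 1 + 2) → ι) 1 = y := rfl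
  rw [h0, h1, planeRestr_lmrOmegaWitness hxy hzx hzy, planeRestr_hessGenMinor_selMatrix]
  have hmat : (Matrix.of fun a b => planeRestr (A := k) x y
      (pderiv ((Fin.cons x (Fin.cons y z : Fin (κ + 1 + 1) → ι) : Fin (κ + 1 + 2) → ι) a)
        (pderiv ((Fin.cons x (Fin.cons y z : Fin (κ + 1 + 1) → ι) :
          Fin (κ + 1 + 2) → ι) b) (lmrOmegaWitness (k := k) κ d x y z)))) =
      Matrix.diagonal (omegaWitnessDiag (k := k) κ d) := by
    refine Matrix.ext fun a b => ?_
    rw [Matrix.of_apply]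
    exact planeRestr_pderiv_pderiv_lmrOmegaWitness (k := k) hinj a b
  rw [hmat, det_diagonal_omegaWitnessDiag hd, lmrR_one_add_X_pow_monomial (by omega)]

/-- **`E(W_{k,d}) ≠ 0` in characteristic zero** (`d ≥ 3`).
[cite: LandsbergManivelRessayre2013, §2.3 (the equation of the flag is not identically zero, p. 473)] -/
theorem lmrEq_lmrOmegaWitness_ne_zero [CharZero k] (hd : 3 ≤ d) (hinj : Function.Injective
      (Fin.cons x (Fin.cons y z : Fin (κ + 1 + 1) → ι) : Fin (κ + 1 + 2) → ι)) :
    lmrEq (Fin.cons x (Fin.cons y z : Fin (κ + 1 + 1) → ι) : Fin (κ + 1 + 2) → ι)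
        (lmrOmegaM κ d) (lmrOmegaWitness (k := k) κ d x y z) ≠ 0 := by
  rw [lmrEq_lmrOmegaWitness hd hinj]
  have h1 : (d : k) ≠ 0 := by exact_mod_cast (show d ≠ 0 by omega)
  have h2 : ((d - 1 : ℕ) : k) ≠ 0 := by exact_mod_cast (show d - 1 ≠ 0 by omega)
  have h3 : (2 : k) ^ (κ + 1) ≠ 0 := pow_ne_zero _ two_ne_zero
  exact mul_ne_zero (pow_ne_zero _ (mul_ne_zero h1 h2)) h3

end Witness

/-! ### §4 The equation of the flag under an upper-triangular substitution -/

section BorelAction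

variable {K : Type*} [Field K] {N κ d : ℕ}

/-- **The equation of the flag transforms by a character under the Borel subgroup** (on the dense set
`P(e_x) ≠ 0`): for `B` upper-triangular and a form `h` of degree `d ≥ 3` on `ℂ^N` with `h(e_{f 0}) ≠ 0`,
`E_f(h ∘ Bᵀ) = det(B|_F)² · B₀₀^{dM+d−1} · B₁₁^{M} · E_f(h)`, `M = (k+3)(d−2) − (d−1)` — eqs. (3)–(5)
of LMR for the full Borel (the shear fixing `D` included, `lmrR_lmrTwist`).
[cite: LandsbergManivelRessayre2013, §2.3, eqs. (3)–(5) (pp. 473–474)] -/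
theorem lmrEq_lmrOmegaFlag_linSubst_of_blockTriangular (hN : κ + 3 ≤ N) (hd : 3 ≤ d)
    {B : Matrix (Fin N) (Fin N) K} (hB : B.BlockTriangular id) {h : MvPolynomial (Fin N) K}
    (hh : h.IsHomogeneous d)
    (h0 : (planeRestr (A := K) (lmrOmegaFlag N κ hN 0) (lmrOmegaFlag N κ hN 1) h).coeff 0 ≠ 0) :
    lmrEq (lmrOmegaFlag N κ hN) (lmrOmegaM κ d) (linSubst (Fin N) K B h) =
      (B.submatrix (lmrOmegaFlag N κ hN) (lmrOmegaFlag N κ hN)).det ^ 2 *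
        B (lmrOmegaFlag N κ hN 0) (lmrOmegaFlag N κ hN 0) ^ (d * lmrOmegaM κ d + (d - 1)) *
        B (lmrOmegaFlag N κ hN 1) (lmrOmegaFlag N κ hN 1) ^ lmrOmegaM κ d *
        lmrEq (lmrOmegaFlag N κ hN) (lmrOmegaM κ d) h := by
  set f := lmrOmegaFlag N κ hN with hf
  set α := B (f 0) (f 0) with hα
  set β := B (f 1) (f 1) with hβ
  set γ := B (f 1) (f 0) with hγ
  have hxy : f 0 ≠ f 1 := fun h => absurd (lmrOmegaFlag_injective hN h) Fin.zero_ne_one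
  -- plane restrictions after the substitution are twists
  have htw : ∀ {Q : MvPolynomial (Fin N) K} {N' : ℕ}, Q.IsHomogeneous N' →
      planeRestr (A := K) (f 0) (f 1) (linSubst (Fin N) K B Q) =
        lmrTwist N' α β γ (planeRestr (A := K) (f 0) (f 1) Q) := by
    intro Q N' hQ
    change lineRestr _ _ (linSubst (Fin N) K B Q) = _
    rw [lineRestr_linSubst, Matrix.single_one_vecMul, Matrix.single_one_vecMul,
      row_lmrOmegaFlag_zero hN hB, row_lmrOmegaFlag_one hN hB, lineRestr_single_eq_lmrTwist hxy α β γ hQ]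
  -- the Hessian minor after the substitution
  have hsel : selMatrix (A := K) f * B = B.submatrix f f * selMatrix (A := K) f :=
    selMatrix_mul_eq_submatrix_mul f (lmrOmegaFlag_injective hN) B
      (fun a j hne => mem_range_lmrOmegaFlag_of_apply_ne_zero hN hB a j hne)
  have hQhom : (hessGenMinor (selMatrix (A := K) f) (selMatrix (A := K) f) h).IsHomogeneous
      ((κ + 1 + 2) * (d - 2)) := isHomogeneous_hessGenMinor _ _ hh
  have hQ : planeRestr (A := K) (f 0) (f 1)
      (hessGenMinor (selMatrix (A := K) f) (selMatrix (A := K) f) (linSubst (Fin N) K B h)) =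
      Polynomial.C ((B.submatrix f f).det ^ 2) *
        lmrTwist ((κ + 1 + 2) * (d - 2)) α β γ (planeRestr (A := K) (f 0) (f 1)
          (hessGenMinor (selMatrix (A := K) f) (selMatrix (A := K) f) h)) := by
    rw [hessGenMinor_linSubst, hsel, hessGenMinor_mul_mul, map_mul, linSubst_C, map_mul,
      planeRestr_C, htw hQhom, pow_two]
  -- degrees and the twist identity
  have hM1 : 1 ≤ lmrOmegaM κ d := one_le_lmrOmegaM hd
  have hp : (planeRestr (A := K) (f 0) (f 1) h).natDegree ≤ d := natDegree_planeRestr_le hxy hh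
  have hq : (planeRestr (A := K) (f 0) (f 1)
      (hessGenMinor (selMatrix (A := K) f) (selMatrix (A := K) f) h)).natDegree ≤
      lmrOmegaM κ d + d - 1 :=
    flag_card_mul_eq_lmrOmegaM (κ := κ) hd ▸ natDegree_planeRestr_le hxy hQhom
  rw [lmrEq, lmrEq, htw hh, hQ, lmrR_C_mul_right, flag_card_mul_eq_lmrOmegaM (κ := κ) hd,
    lmrR_lmrTwist hM1 (by omega) hp hq h0]
  ring

end BorelAction

/-! ### §5 The weight `Ω(k,d)^*` on the Borel subgroup -/

section Weights

variable {N κ d : ℕ}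

/-- The sorted parts of `Ω(k,d)` (`d ≥ 3`): `[dM + d + 1, M + 2, 2, …, 2]` (`k+1` trailing `2`'s).
[cite: LandsbergManivelRessayre2013, Theorem 2.3.1 (p. 474)] -/
theorem sortedParts_lmrOmegaPartition (hd : 3 ≤ d) :
    (lmrOmegaPartition κ d).sortedParts =
      (d * lmrOmegaM κ d + (d - 1) + 2) :: (lmrOmegaM κ d + 2) :: List.replicate (κ + 1) 2 := by
  have hab : lmrOmegaM κ d + 2 ≤ d * lmrOmegaM κ d + (d - 1) + 2 := by
    have h1 : 1 * lmrOmegaM κ d ≤ d * lmrOmegaM κ d := Nat.mul_le_mul_right _ (by omega)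
    omega
  have hb2 : 2 ≤ lmrOmegaM κ d + 2 := by omega
  rw [Nat.Partition.sortedParts, lmrOmegaPartition_parts hd, lmrOmegaParts, lmrOmegaParts_fst_eq hd,
    lmrOmegaParts_snd_eq hd,
    show ((d * lmrOmegaM κ d + (d - 1) + 2) ::ₘ (lmrOmegaM κ d + 2) ::ₘ Multiset.replicate (κ + 1) 2
      : Multiset ℕ) = (((d * lmrOmegaM κ d + (d - 1) + 2) :: (lmrOmegaM κ d + 2) ::
        List.replicate (κ + 1) 2 : List ℕ) : Multiset ℕ) by
      rw [← Multiset.coe_replicate, ← Multiset.cons_coe, ← Multiset.cons_coe],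
    Multiset.coe_sort]
  apply List.mergeSort_eq_self
  refine List.pairwise_cons.mpr ⟨fun z hz => ?_, List.pairwise_cons.mpr ⟨fun z hz => ?_, ?_⟩⟩
  · rcases List.mem_cons.mp hz with rfl | hz'
    · exact hab
    · rw [List.eq_of_mem_replicate hz']; exact hb2.trans hab
  · rw [List.eq_of_mem_replicate hz]; exact hb2
  · exact List.pairwise_replicate.mpr (Or.inr le_rfl)

/-- The weight `Ω(k,d)^*` (`Weight.dualOfPartition N`) along the flag of the `k+3` greatest
coordinates of `ℂ^N`: `χ(f a) = −Ω_{a+1}`, `χ = 0` off the flag; consequently, on an upper-triangular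
`g` with `B = g⁻¹`, `χ(g) = det(B|_F)² · B₀₀^{dM+d−1} · B₁₁^{M}` — the exponent vector
`(a+b+c, b+c, c^{(k+1)})` of LMR. [cite: LandsbergManivelRessayre2013, §2.3 (p. 474)] -/
theorem weightChar_lmrOmegaPartition (hN : κ + 3 ≤ N) (hd : 3 ≤ d) {g : GL (Fin N) ℂ}
    (hg : IsUpperTriangular g) :
    weightChar (Weight.dualOfPartition N (lmrOmegaPartition κ d)) g =
      (((g⁻¹ : GL (Fin N) ℂ) : Matrix (Fin N) (Fin N) ℂ).submatrix
          (lmrOmegaFlag N κ hN) (lmrOmegaFlag N κ hN)).det ^ 2 *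
        ((g⁻¹ : GL (Fin N) ℂ) : Matrix (Fin N) (Fin N) ℂ) (lmrOmegaFlag N κ hN 0)
          (lmrOmegaFlag N κ hN 0) ^ (d * lmrOmegaM κ d + (d - 1)) *
        ((g⁻¹ : GL (Fin N) ℂ) : Matrix (Fin N) (Fin N) ℂ) (lmrOmegaFlag N κ hN 1)
          (lmrOmegaFlag N κ hN 1) ^ lmrOmegaM κ d := by
  set χ := Weight.dualOfPartition N (lmrOmegaPartition κ d) with hχ
  set B : Matrix (Fin N) (Fin N) ℂ := ((g⁻¹ : GL (Fin N) ℂ) : Matrix (Fin N) (Fin N) ℂ) with hBdef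
  set f := lmrOmegaFlag N κ hN with hf
  set L : List ℕ := (lmrOmegaPartition κ d).sortedParts with hL
  have hg' : IsUpperTriangular g⁻¹ := (borelSubgroup (Fin N) ℂ).inv_mem hg
  have hB : B.BlockTriangular id := hg'
  -- (W1) χ(g) = χ(g⁻¹)⁻¹
  have h1 : weightChar χ g * weightChar χ g⁻¹ = 1 := by
    rw [← weightChar_mul χ hg hg', mul_inv_cancel, weightChar_one]
  rw [eq_inv_of_mul_eq_one_left h1]
  -- (W2–W5) χ(g⁻¹) = (∏_j d_j ^ L_j)⁻¹ over j : Fin N, d_j = B (rev j) (rev j)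
  have hval : ∀ j : Fin N, χ (Fin.rev j) = -((L.getD j 0 : ℕ) : ℤ) := by
    intro j
    simp [hχ, hL, Weight.dualOfPartition, Weight.dual, Weight.ofPartition, Fin.rev_rev]
  have h2 : weightChar χ g⁻¹ = (∏ j : Fin N, B (Fin.rev j) (Fin.rev j) ^ L.getD j 0)⁻¹ := by
    rw [weightChar, ← Finset.prod_inv_distrib]
    refine (Fintype.prod_equiv Fin.revPerm _ _ fun j => ?_).symm
    rw [Fin.revPerm_apply, hval, _root_.zpow_neg, zpow_natCast]
  rw [h2, inv_inv]
  -- (W6) restrict to the flag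
  have hlen : L.length = κ + 1 + 2 := by
    rw [hL, sortedParts_lmrOmegaPartition hd, List.length_cons, List.length_cons, List.length_replicate]
  have h3 : ∏ j : Fin N, B (Fin.rev j) (Fin.rev j) ^ L.getD j 0 =
      ∏ a : Fin (κ + 1 + 2), B (f a) (f a) ^ L.getD a 0 := by
    have step : ∏ a : Fin (κ + 1 + 2), B (f a) (f a) ^ L.getD a 0 =
        ∏ j ∈ (Finset.univ : Finset (Fin (κ + 1 + 2))).map (Fin.castLEEmb hN),
          B (Fin.rev j) (Fin.rev j) ^ L.getD j 0 := by
      rw [Finset.prod_map]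
      rfl
    rw [step]
    refine (Finset.prod_subset (Finset.subset_univ _) fun j _ hj => ?_).symm
    have hjl : L.length ≤ j := by
      rw [hlen]
      by_contra hlt
      apply hj
      rw [Finset.mem_map]
      exact ⟨⟨j, not_le.mp hlt⟩, Finset.mem_univ _, Fin.ext rfl⟩
    rw [List.getD_eq_default _ _ hjl, pow_zero]
  rw [h3, det_submatrix_lmrOmegaFlag hN hB]
  -- (W7–W8) both sides as products over the flag, split off a = 0, 1
  conv_lhs => rw [Fin.prod_univ_succ, Fin.prod_univ_succ]
  conv_rhs => rw [Fin.prod_univ_succ, Fin.prod_univ_succ]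
  have hL0 : L.getD ((0 : Fin (κ + 1 + 2)) : ℕ) 0 = d * lmrOmegaM κ d + (d - 1) + 2 := by
    rw [hL, sortedParts_lmrOmegaPartition hd, Fin.val_zero, List.getD_cons_zero]
  have hL1 : L.getD ((Fin.succ (0 : Fin (κ + 1 + 1))) : ℕ) 0 = lmrOmegaM κ d + 2 := by
    rw [hL, sortedParts_lmrOmegaPartition hd, Fin.val_succ, Fin.val_zero, List.getD_cons_succ,
      List.getD_cons_zero]
  have hL2 : ∀ c : Fin (κ + 1), L.getD ((c.succ.succ : Fin (κ + 1 + 2)) : ℕ) 0 = 2 := by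
    intro c
    rw [hL, sortedParts_lmrOmegaPartition hd, Fin.val_succ, Fin.val_succ, List.getD_cons_succ,
      List.getD_cons_succ, List.getD_replicate _ c.2]
  rw [hL0, hL1]
  simp only [hL2, Finset.prod_pow, hf, Fin.succ_zero_eq_one]
  ring

end Weights

/-! ### §6 The equation of the flag is a highest-weight vector of weight `Ω(k,d)^*` -/

section Hwv

variable {N κ d : ℕ}

/-- **LMR's equation of the flag of the `k+3` greatest coordinates of `ℂ^N` is a highest-weight vector
of `ℂ[S^d ℂ^N]` of weight `Ω(k,d)^*`** (`d ≥ 3`, `k+3 ≤ N`). LMR 2013 §2.3: "This equation must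
therefore be a highest weight vector in some module of polynomials on `S^n W^*`, and its highest
weight must be of the form `aω_1 + bω_2 + cω_{k+3}`" (journal p. 473, `paper:galaxy-pdf-8572435590081880720
p0006.txt:L13–29`), with Thm. 2.3.1 (p. 474). Proof: on the dense set `{h(e_{f 0}) ≠ 0}` of `S^d`,
`g·E_f` and `χ(g)E_f` agree (§4–§5); so `(g·E_f − χ(g)E_f) · X_{x^d} = 0` identically.
[cite: LandsbergManivelRessayre2013, §2.3 and Theorem 2.3.1 (pp. 473–474)] -/
theorem lmrEqCoord_lmrOmegaFlag_mem_highestWeightSpace (hN : κ + 3 ≤ N) (hd : 3 ≤ d) :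
    lmrEqCoord (k := ℂ) (lmrOmegaFlag N κ hN) (lmrOmegaM κ d) d ∈
      highestWeightSpace (coordRep (Fin N) ℂ d) (Weight.dualOfPartition N (lmrOmegaPartition κ d)) := by
  rw [mem_highestWeightSpace_iff]
  intro g hg
  rw [coordRep_apply]
  set F := lmrEqCoord (k := ℂ) (lmrOmegaFlag N κ hN) (lmrOmegaM κ d) d with hF
  set c := weightChar (Weight.dualOfPartition N (lmrOmegaPartition κ d)) g with hc
  set B : Matrix (Fin N) (Fin N) ℂ := ((g⁻¹ : GL (Fin N) ℂ) : Matrix (Fin N) (Fin N) ℂ) with hBdef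
  have hg' : IsUpperTriangular g⁻¹ := (borelSubgroup (Fin N) ℂ).inv_mem hg
  have hB : B.BlockTriangular id := hg'
  have hxy : lmrOmegaFlag N κ hN 0 ≠ lmrOmegaFlag N κ hN 1 := fun h =>
    absurd (lmrOmegaFlag_injective hN h) Fin.zero_ne_one
  -- the monomial `x^d` of the top coordinate, as a coordinate of `Sym^d`
  let δ₀ : DegIdx (Fin N) d :=
    ⟨Finsupp.single (lmrOmegaFlag N κ hN 0) d, mem_degMonomials_iff.mpr (Finsupp.degree_single _ _)⟩
  -- evaluation identity on the dense set `v δ₀ ≠ 0`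
  have hev : ∀ v : DegIdx (Fin N) d → ℂ, v δ₀ ≠ 0 →
      MvPolynomial.eval v (coordSubst d g F) = MvPolynomial.eval v (c • F) := by
    intro v hv
    set h : MvPolynomial (Fin N) ℂ := ∑ δ : DegIdx (Fin N) d, monomial δ.1 (v δ) with hh
    have hhom : h.IsHomogeneous d := isHomogeneous_sum_monomial v
    have hfc : formCoeff d h = v := formCoeff_sum_monomial v
    have hL : MvPolynomial.eval v (coordSubst d g F) =
        lmrEq (lmrOmegaFlag N κ hN) (lmrOmegaM κ d) (linSubst (Fin N) ℂ B h) := by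
      have e1 : MvPolynomial.eval v (coordSubst d g F) =
          MvPolynomial.aeval (formCoeff d h) (coordSubst d g F) := by
        rw [hfc]
        rfl
      rw [e1, aeval_formCoeff_coordSubst, linSubstRep_apply,
        aeval_formCoeff_lmrEqCoord _ _ (linSubst_isHomogeneous _ hhom)]
    have hR : MvPolynomial.eval v (c • F) = c * lmrEq (lmrOmegaFlag N κ hN) (lmrOmegaM κ d) h := by
      rw [MvPolynomial.smul_eq_C_mul, map_mul, MvPolynomial.eval_C, hF, eval_lmrEqCoord]
    have h0 : (planeRestr (A := ℂ) (lmrOmegaFlag N κ hN 0) (lmrOmegaFlag N κ hN 1) h).coeff 0 ≠ 0 := by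
      rw [coeff_zero_planeRestr hxy hhom]
      have : MvPolynomial.coeff (Finsupp.single (lmrOmegaFlag N κ hN 0) d) h = formCoeff d h δ₀ := rfl
      rwa [this, hfc]
    rw [hL, hR, lmrEq_lmrOmegaFlag_linSubst_of_blockTriangular hN hd hB hhom h0, hc,
      weightChar_lmrOmegaPartition hN hd hg]
  -- density: `(g·F − c F) · X_{δ₀}` vanishes identically
  have hΦ : (coordSubst d g F - c • F) * X δ₀ = 0 := by
    apply MvPolynomial.funext
    intro v
    rw [map_mul, MvPolynomial.eval_X, map_zero]
    by_cases hv : v δ₀ = 0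
    · rw [hv, mul_zero]
    · rw [map_sub, hev v hv, sub_self, zero_mul]
  have hzero : coordSubst d g F - c • F = 0 :=
    (mul_eq_zero.mp hΦ).resolve_right (X_ne_zero δ₀)
  exact sub_eq_zero.mp hzero

/-- **The equation of the flag is homogeneous of degree `(k+2)(d−1)`** ("These equations have degree
`(k+2)(d−1)`"). [cite: LandsbergManivelRessayre2013, Theorem 2.3.1 (p. 474)] -/
theorem lmrEqCoord_lmrOmegaFlag_isHomogeneous (hN : κ + 3 ≤ N) (hd : 3 ≤ d) :
    (lmrEqCoord (k := ℂ) (lmrOmegaFlag N κ hN) (lmrOmegaM κ d) d).IsHomogeneous ((κ + 2) * (d - 1)) := by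
  haveI : Infinite ℂ := CharZero.infinite ℂ
  rw [← flag_card_add_lmrOmegaM (κ := κ) hd]
  exact lmrEqCoord_isHomogeneous (k := ℂ) _ _ _

/-- **The equation of the flag is nonzero** (it does not vanish at the test form `W_{k,d}`).
[cite: LandsbergManivelRessayre2013, Theorem 2.3.1 (p. 474)] -/
theorem lmrEqCoord_lmrOmegaFlag_ne_zero (hN : κ + 3 ≤ N) (hd : 3 ≤ d) :
    lmrEqCoord (k := ℂ) (lmrOmegaFlag N κ hN) (lmrOmegaM κ d) d ≠ 0 := by
  set f := lmrOmegaFlag N κ hN with hf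
  have hcons : (Fin.cons (f 0) (Fin.cons (f 1) (fun c => f c.succ.succ) :
      Fin (κ + 1 + 1) → Fin N) : Fin (κ + 1 + 2) → Fin N) = f := by
    funext a
    cases a using Fin.cases with
    | zero => rfl
    | succ a' =>
      cases a' using Fin.cases with
      | zero => rfl
      | succ c => rfl
  have hinj : Function.Injective (Fin.cons (f 0) (Fin.cons (f 1) (fun c => f c.succ.succ) :
      Fin (κ + 1 + 1) → Fin N) : Fin (κ + 1 + 2) → Fin N) := by
    rw [hcons]
    exact lmrOmegaFlag_injective hN
  have hE := lmrEq_lmrOmegaWitness_ne_zero (k := ℂ) (d := d) hd hinj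
  rw [hcons] at hE
  exact lmrEqCoord_ne_zero (k := ℂ) f (lmrOmegaM κ d) (lmrOmegaWitness_isHomogeneous (k := ℂ) hd _ _ _) hE

end Hwv

/-! ### §7 The equation of the flag vanishes on `Dual_{k,d,N}` (modulo B. Segre's formula) -/

section Vanishing

variable {A : Type*} [CommRing A] {ι : Type*} [Fintype ι] [DecidableEq ι] {κ d : ℕ}

/-- **Divisibility kills the equation of a flag**: for a form `Q` of degree `d ≥ 3` over a commutative
ring and a coordinate flag `f` (`f 0 ≠ f 1`) with `Q ∣ det(H_Q|_F)`, `E_f(Q) = 0` at truncation order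
`M = (k+3)(d−2) − (d−1)`: write `det(H_Q|_F) = Q · D`, replace `D` by its component of degree
`e − d = M − 1` and apply `lmrEq_eq_zero_of_eq_mul` (LMR 2013 §2.2: "`P ∈ Dual_{k,d,N}` iff for every
`F`, `P` divides `det(H_P|_F)` … `D_L` contributes only up to degree `e − d`", pp. 472–473).
[cite: LandsbergManivelRessayre2013, §2.2 eqs. (1)–(2) (pp. 472–473)] -/
theorem lmrEq_eq_zero_of_dvd_hessGenMinor (hd : 3 ≤ d) {f : Fin (κ + 1 + 2) → ι} (hf : f 0 ≠ f 1)
    {Q : MvPolynomial ι A} (hQ : Q.IsHomogeneous d)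
    (hdvd : Q ∣ hessGenMinor (selMatrix f) (selMatrix f) Q) :
    lmrEq f (lmrOmegaM κ d) Q = 0 := by
  classical
  obtain ⟨D, hD⟩ := hdvd
  set e := (κ + 1 + 2) * (d - 2) with he
  have hde : d ≤ e := by
    have : 3 * (d - 2) ≤ (κ + 1 + 2) * (d - 2) := Nat.mul_le_mul_right _ (by omega)
    omega
  have hQmin : (hessGenMinor (selMatrix (A := A) f) (selMatrix f) Q).IsHomogeneous e :=
    isHomogeneous_hessGenMinor _ _ hQ
  set D' := homogeneousComponent (e - d) D with hD'
  have hD'hom : D'.IsHomogeneous (e - d) := homogeneousComponent_isHomogeneous _ _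
  have hQ' : hessGenMinor (selMatrix (A := A) f) (selMatrix f) Q = Q * D' := by
    rw [← homogeneousComponent_eq_self hQmin, hD, homogeneousComponent_mul_left hQ D hde]
  refine lmrEq_eq_zero_of_eq_mul f (lmrOmegaM κ d) hQ' ?_
  have hdeg : (planeRestr (A := A) (f 0) (f 1) D').natDegree ≤ e - d := natDegree_planeRestr_le hf hD'hom
  have heM : e = lmrOmegaM κ d + d - 1 := flag_card_mul_eq_lmrOmegaM (κ := κ) hd
  have hM1 : 1 ≤ lmrOmegaM κ d := one_le_lmrOmegaM hd
  omega

/-- **Irreducible forms with degenerate Hessian on their zero set satisfy the equation of every flag**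
(LMR 2013 §2.1, p. 472: "`P ∈ Dual_{k,d,N}` if and only if … `det(H_{P,w}|_F) = 0` … Equivalently
(assuming `P` is irreducible), … `P` must divide `det(H_P|_F)`" — Hilbert's Nullstellensatz, tree
`dvd_of_prime_of_forall_eval_eq_zero`): over `ℂ`, if `Q` is irreducible of degree `d ≥ 3` and the
Hessian of `Q` has rank `≤ k+2` at the zeros of `Q` outside a hypersurface `{g = 0}` not containing
`Z(Q)`, then `E_f(Q) = 0` for every coordinate flag `f`.
[cite: LandsbergManivelRessayre2013, §2.1 (p. 472)] -/
theorem lmrEq_eq_zero_of_rank_hessian_le (hd : 3 ≤ d) {f : Fin (κ + 1 + 2) → ι} (hf : f 0 ≠ f 1)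
    {Q : MvPolynomial ι ℂ} (hQ : Q.IsHomogeneous d) (hirr : Irreducible Q) {g : MvPolynomial ι ℂ}
    (hg : ∃ w : ι → ℂ, eval w Q = 0 ∧ eval w g ≠ 0)
    (hrank : ∀ w : ι → ℂ, eval w Q = 0 → eval w g ≠ 0 → (hessianMatrix Q w).rank ≤ κ + 2) :
    lmrEq f (lmrOmegaM κ d) Q = 0 := by
  classical
  have hprime : Prime Q := UniqueFactorizationMonoid.irreducible_iff_prime.mp hirr
  refine lmrEq_eq_zero_of_dvd_hessGenMinor hd hf hQ ?_
  have hdvd : Q ∣ hessGenMinor (selMatrix (A := ℂ) f) (selMatrix f) Q * g := by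
    refine dvd_of_prime_of_forall_eval_eq_zero hprime fun x hx => ?_
    rw [map_mul]
    by_cases hgx : eval x g = 0
    · rw [hgx, mul_zero]
    · rw [eval_hessGenMinor, det_mul_mul_transpose_eq_zero_of_rank_le
        ((hrank x hx hgx).trans (by omega)) (selMatrix f) (selMatrix f), zero_mul]
  rcases hprime.dvd_or_dvd hdvd with h | h
  · exact h
  · exfalso
    obtain ⟨w₀, hw₀Q, hw₀g⟩ := hg
    obtain ⟨t, ht⟩ := h
    apply hw₀g
    rw [ht, map_mul, hw₀Q, zero_mul]

/-- The equation of a flag, as a polynomial function on `S^d` (`lmrEqCoord`), vanishes at every point of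
`Dual_{k,d,N}` (the Zariski closure, in coefficient space, of the irreducible forms `Q` of degree `d` with
`dim Z(Q)^* ≤ k`) as soon as it vanishes at those forms `Q`: it is a polynomial in the coefficients.
[cite: LandsbergManivelRessayre2013, §2.3 (p. 474)] -/
theorem aeval_formCoeff_lmrEqCoord_eq_zero_of_mem_dualDegenerateLocus {f : Fin (κ + 1 + 2) → ι}
    {M : ℕ}
    (h0 : ∀ Q : MvPolynomial ι ℂ, Q.IsHomogeneous d → Irreducible Q → dualVarietyDim Q ≤ κ →
      lmrEq f M Q = 0)
    {P : MvPolynomial ι ℂ} (hP : P ∈ dualDegenerateLocus (σ := ι) κ d) :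
    aeval (formCoeff d P) (lmrEqCoord (k := ℂ) f M d) = 0 := by
  have key : ∀ R : MvPolynomial ι ℂ, aeval (formCoeff d R) (lmrEqCoord (k := ℂ) f M d) =
      aeval (coeffVec R) (rename (Subtype.val : DegIdx ι d → (ι →₀ ℕ)) (lmrEqCoord (k := ℂ) f M d)) := by
    intro R
    rw [aeval_rename]
    rfl
  rw [key]
  rw [dualDegenerateLocus, Set.mem_setOf_eq, mem_zariskiClosure_iff] at hP
  refine hP _ ?_
  rintro _ ⟨Q, ⟨hQ, hirr, hdim⟩, rfl⟩
  rw [← key, aeval_formCoeff_lmrEqCoord f M hQ]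
  exact h0 Q hQ hirr hdim

end Vanishing

/-! ### §8 Theorem 2.3.1 -/

section Main

variable {N κ d : ℕ}

/-- **The Segre-free content of Theorem 2.3.1, PROVED**: for `d ≥ 3` and `k + 3 ≤ N`, LMR's equation
`E_f` of the flag of the `k+3` greatest coordinates of `ℂ^N` (as the polynomial function
`lmrEqCoord f M d` on `S^d ℂ^N`, `M = (k+3)(d−2) − (d−1)`) is NONZERO, homogeneous of degree
`(k+2)(d−1)`, a highest-weight vector of weight `Ω(k,d)^*`, and vanishes at every form `Q` of degree `d`
dividing `det(H_Q|_F)`. [cite: LandsbergManivelRessayre2013, Theorem 2.3.1 (p. 474)] -/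
theorem lmrEqCoord_lmrOmegaFlag_spec (hN : κ + 3 ≤ N) (hd : 3 ≤ d) :
    lmrEqCoord (k := ℂ) (lmrOmegaFlag N κ hN) (lmrOmegaM κ d) d ≠ 0 ∧
    (lmrEqCoord (k := ℂ) (lmrOmegaFlag N κ hN) (lmrOmegaM κ d) d).IsHomogeneous ((κ + 2) * (d - 1)) ∧
    lmrEqCoord (k := ℂ) (lmrOmegaFlag N κ hN) (lmrOmegaM κ d) d ∈
      highestWeightSpace (coordRep (Fin N) ℂ d) (Weight.dualOfPartition N (lmrOmegaPartition κ d)) ∧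
    ∀ Q : MvPolynomial (Fin N) ℂ, Q.IsHomogeneous d →
      Q ∣ hessGenMinor (selMatrix (lmrOmegaFlag N κ hN)) (selMatrix (lmrOmegaFlag N κ hN)) Q →
        aeval (formCoeff d Q) (lmrEqCoord (k := ℂ) (lmrOmegaFlag N κ hN) (lmrOmegaM κ d) d) = 0 := by
  refine ⟨lmrEqCoord_lmrOmegaFlag_ne_zero hN hd, lmrEqCoord_lmrOmegaFlag_isHomogeneous hN hd,
    lmrEqCoord_lmrOmegaFlag_mem_highestWeightSpace hN hd, fun Q hQ hdvd => ?_⟩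
  have hxy : lmrOmegaFlag N κ hN 0 ≠ lmrOmegaFlag N κ hN 1 := fun h =>
    absurd (lmrOmegaFlag_injective hN h) Fin.zero_ne_one
  rw [aeval_formCoeff_lmrEqCoord _ _ hQ]
  exact lmrEq_eq_zero_of_dvd_hessGenMinor hd hxy hQ hdvd

/-- **Theorem 2.3.1 modulo the Hessian-rank half of B. Segre's formula.** If for every irreducible form
`P` of degree `d ≥ 2` on every `ℂ^N` the Hessian has rank `≤ dim Z(P)^* + 2` at the zeros of `P` off a
hypersurface not containing `Z(P)` (the inequality `≤` of `SegreDimensionFormula`, "`dim Z(P)^* ≤ k`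
iff … the rank of its Hessian is at most `k+2`", LMR §2.1 p. 472), then `LMR2013_thm_2_3_1` holds,
with `F = E_f` the equation of the flag of the `k+3` greatest coordinates.
[cite: LandsbergManivelRessayre2013, Theorem 2.3.1 (p. 474), §2.1 (p. 472)] -/
theorem LMR2013_thm_2_3_1_of_hessianRankBound
    (hE : ∀ (N : ℕ) (P : MvPolynomial (Fin N) ℂ) (d : ℕ), 2 ≤ d → P.IsHomogeneous d → Irreducible P →
      ∃ g : MvPolynomial (Fin N) ℂ, (∃ w : Fin N → ℂ, eval w P = 0 ∧ eval w g ≠ 0) ∧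
        ∀ w : Fin N → ℂ, eval w P = 0 → eval w g ≠ 0 →
          (hessianMatrix P w).rank ≤ dualVarietyDim P + 2) :
    LMR2013_thm_2_3_1 := by
  intro N κ d hN hd
  obtain ⟨hne, hhom, hhwv, -⟩ := lmrEqCoord_lmrOmegaFlag_spec hN hd
  refine ⟨lmrEqCoord (k := ℂ) (lmrOmegaFlag N κ hN) (lmrOmegaM κ d) d, hne, hhom, hhwv, fun P hP => ?_⟩
  have hxy : lmrOmegaFlag N κ hN 0 ≠ lmrOmegaFlag N κ hN 1 := fun h =>
    absurd (lmrOmegaFlag_injective hN h) Fin.zero_ne_one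
  refine aeval_formCoeff_lmrEqCoord_eq_zero_of_mem_dualDegenerateLocus (fun Q hQ hirr hdim => ?_) hP
  obtain ⟨g, hg, hrank⟩ := hE N Q d (by omega) hQ hirr
  exact lmrEq_eq_zero_of_rank_hessian_le hd hxy hQ hirr hg
    fun w hw hgw => (hrank w hw hgw).trans (by omega)

/-- **Theorem 2.3.1 modulo B. Segre's dimension formula** (the tree's named fact
`SegreDimensionFormula`, GKZ 1994 / Landsberg 2017 Prop. 6.4.5.1 — the only non-elementary input of
the printed proof, exactly as for `LMR2013_thm_1_2_1_of_segreDimensionFormula`): granted Segre's formula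
on every `ℂ^N`, `LMR2013_thm_2_3_1` holds. [cite: LandsbergManivelRessayre2013, Theorem 2.3.1 (p. 474), §2.1 (p. 471)] -/
theorem LMR2013_thm_2_3_1_of_segreDimensionFormula (hS : ∀ N : ℕ, SegreDimensionFormula (σ := Fin N)) :
    LMR2013_thm_2_3_1 :=
  LMR2013_thm_2_3_1_of_hessianRankBound fun N P d h2 hP hirr => by
    obtain ⟨g, hg, h⟩ := hS N P d h2 hP hirr
    exact ⟨g, hg, fun w hw hgw => (h w hw hgw).le⟩

/-- **Discharge of `LMR2013_thm_2_3_1`** (Landsberg–Manivel–Ressayre 2013, Theorem 2.3.1, journal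
p. 474, `paper:galaxy-pdf-8572435590081880720 p0006.txt:L33–37`): for `N ≥ k+3`, `d ≥ 3`, LMR's equation
`E_f` of the flag of the `k+3` greatest coordinates of `ℂ^N` is a nonzero highest-weight vector of
weight `Ω(k,d)^* = ((d−1)(d−2)(k+2)ω₁ + (d(k+2)−2k−5)ω₂ + 2ω_{k+3})^*` of `ℂ[S^d ℂ^N]`, homogeneous of
degree `(k+2)(d−1)`, vanishing on `Dual_{k,d,N}` — B. Segre's formula being the theorem
`segreDimensionFormula_holds`. [cite: LandsbergManivelRessayre2013, Theorem 2.3.1 (p. 474)] -/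
theorem LMR2013_thm_2_3_1_holds : LMR2013_thm_2_3_1 :=
  LMR2013_thm_2_3_1_of_segreDimensionFormula fun _ => segreDimensionFormula_holds

end Main

end Literature.Computability.AlgebraicComplexity
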